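import Mathlib
import Summits.CriticalPhenomena.CardyFormulaZ2.Theses.CardyMagicRigidity
import Summits.CriticalPhenomena.CardyFormulaZ2.Theorems.CardyMagicRigidityTransferContinuityReduction
import Summits.CriticalPhenomena.CardyFormulaZ2.Theorems.CardyMagicRigidityMagicFormulaTAprioriBounds
import Summits.CriticalPhenomena.CardyFormulaZ2.Theorems.CardyMagicRigidityMagicFormulaTCloseComparison
import Summits.CriticalPhenomena.CardyFormulaZ2.Theorems.CardyMagicRigidityMagicFormulaTRibbonRarity
import Summits.CriticalPhenomena.CardyFormulaZ2.Theorems.CardyMagicRigidityMagicFormulaTExistsLimit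
import HarnessLib

/-!
# `MagicFormulaT` = EXISTENCE ∧ IDENTIFICATION: the existence half is a theorem modulo two published facts

Crux `Summit.CriticalPhenomena.CardyFormulaZ2.Theses.CardyMagicRigidity.MagicFormulaT`
(stmt-CriticalPhenomena-4836), line `Sketch`, skeleton v7 (lead c3).  Two citable corollaries of the landed
stubs A (`stub_aprioriBounds`), B (`stub_closeComparison`), R (`stub_ribbonRarity`), E (`stub_existsLimit`):

* `existsLimitT_of_facts` — **the scaling limit `L(f) = lim_{δ→0⁺} Λ^𝕋_δ(f)` of the site-`𝕋` twisted nesting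
  transform EXISTS for every admissible density**, conditionally on Camia–Newman's full-plane CLE₆ limit
  (`exists_isFullPlaneCNLLaw`, Comm. Math. Phys. 268 (2006) Thms 1/6) and Smirnov–Werner's four-arm scaling limit
  (`SmirnovWerner2001_fourArm_scalingLimit`, Math. Res. Lett. 8 (2001)); both are NAMED FACTS of the tree taken as
  hypotheses (conditional result; nothing is closed by this file).
* `magicFormulaT_iff_identification` — given the same two facts, **the crux is EQUIVALENT to the identification of
  that limit with the Gaussian functional** `exp((3/4π²)∬ log‖x−y‖ f f)` (T1, "bosonisation of full-plane CLE₆ is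
  exact", no theorem in print): `→` by uniqueness of limits, `←` by existence.  This is the exact residue of the
  crux after the line `Sketch`.
-/

noncomputable section

namespace Summit.CriticalPhenomena.CardyFormulaZ2.Cruxes.MagicFormulaT.LineSketch

open MeasureTheory Filter Set
open scoped Real Topology BigOperators ENNReal
open Literature.Probability.RandomPlanarGeometry Literature.Probability.Percolation
  Literature.Probability.LatticeModels

/-- **Existence of the scaling limit of the site-`𝕋` twisted nesting transform, modulo Camia–Newman and
Smirnov–Werner** (registered sub-goal `existsLimitT_of_facts`; CONDITIONAL on the two named facts). -/
theorem existsLimitT_of_facts : exists_isFullPlaneCNLLaw → SmirnovWerner2001_fourArm_scalingLimit → ∀ (f : ℂ → ℝ) (R C : ℝ), Measurable f → (∀ z, |f z| ≤ C) → (∀ z, R < ‖z‖ → f z = 0) → ∫ z, f z = 0 → ∃ L : ℝ, Filter.Tendsto (fun δ : ℝ ↦ truncNestingTransform (triSitePercolation half) (siteLoopConfig δ) f 0) (nhdsWithin 0 (Set.Ioi 0)) (nhds L) :=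
  fun hCN hSW ↦ stub_existsLimit hCN stub_aprioriBounds stub_closeComparison (stub_ribbonRarity hSW)

/-- **The crux `MagicFormulaT` is equivalent, given Camia–Newman and Smirnov–Werner, to the identification of the
limit with the Gaussian functional** (registered sub-goal `magicFormulaT_iff_identification`). -/
theorem magicFormulaT_iff_identification : exists_isFullPlaneCNLLaw → SmirnovWerner2001_fourArm_scalingLimit → (Summit.CriticalPhenomena.CardyFormulaZ2.Theses.CardyMagicRigidity.MagicFormulaT ↔ ∀ (f : ℂ → ℝ) (R C : ℝ), Measurable f → (∀ z, |f z| ≤ C) → (∀ z, R < ‖z‖ → f z = 0) → ∫ z, f z = 0 → ∀ L : ℝ, Filter.Tendsto (fun δ : ℝ ↦ truncNestingTransform (triSitePercolation half) (siteLoopConfig δ) f 0) (nhdsWithin 0 (Set.Ioi 0)) (nhds L) → L = Real.exp (3 / (4 * Real.pi ^ 2) * ∫ x, ∫ y, Real.log ‖x - y‖ * f x * f y)) := by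
  intro hCN hSW
  constructor
  · intro hM f R C hf hC hR h0 L hL
    have hG := hM f R C hf hC hR h0
    have hG' : Tendsto (fun δ : ℝ ↦ truncNestingTransform (triSitePercolation half) (siteLoopConfig δ) f 0)
        (𝓝[>] 0) (𝓝 (Real.exp (3 / (4 * Real.pi ^ 2) * ∫ x, ∫ y, Real.log ‖x - y‖ * f x * f y))) :=
      hG.congr' (Eventually.of_forall fun δ ↦ Theorems.integral_site_eq f δ)
    exact tendsto_nhds_unique hL hG'
  · intro hI f R C hf hC hR h0
    obtain ⟨L, hL⟩ := existsLimitT_of_facts hCN hSW f R C hf hC hR h0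
    have hLeq := hI f R C hf hC hR h0 L hL
    rw [hLeq] at hL
    exact hL.congr' (Eventually.of_forall fun δ ↦ (Theorems.integral_site_eq f δ).symm)

end Summit.CriticalPhenomena.CardyFormulaZ2.Cruxes.MagicFormulaT.LineSketch

end
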